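import Literature.Geometry.Riemannian.KernelNashEntropyPole
import Literature.Geometry.Riemannian.HeatKernelPoincare
import Literature.Geometry.Riemannian.RicciFlowScalarCurvatureHolds
import HarnessLib

/-!
# Bamler's integral bounds for the potential of the conjugate heat kernel
# (Bamler 2020a, §5.1, the proposition "further interesting bounds"; arXiv v1 Prop. 21)

R. Bamler, *Entropy and heat kernel bounds on a Ricci flow background*, arXiv:2008.07093 (2020a),
§5.1, last proposition of the subsection (arXiv v1: Proposition 21): if
`dν = (4πτ)^{-n/2} e^{-f} dg` denotes the conjugate heat kernel based at `(x₀, t₀)` and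
`R(·, t₀ − τ) ≥ R_min`, then

  (a) `∫_M τ (|∇f|² + R) dν_{t₀−τ} ≤ n/2`,
  (b) `∫_M (f − 𝒩_{x₀,t₀}(τ) − n/2)² dν_{t₀−τ} ≤ n − 2 R_min τ`.

Bamler's proof: (a) is `∫ τ(|∇f|² + R) dν = n/2 + 𝒲 − 𝒩 ≤ n/2` by Prop. 5.2 (`𝒲 ≤ 𝒩`); (b) is
Hein–Naber's `L²`-Poincaré inequality applied to `f` (whose `ν`-mean is `𝒩 + n/2`) followed by
(a). This file PROVES both for the conjugate heat kernel `K = K(x₀,t₀;·,·)` of a Ricci flow on a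
closed manifold (`IsRicciFlow.heatKernelFn`, `RicciFlowHeatKernelFn.lean`), in the tree's
rendering `u r y = K t₀ x₀ (y, r)`, `f = entropyPotential u m t₀ r`, `τ = t₀ − r`,
`𝒩 = pointedNashEntropy g u m t₀ r`:

* `IsRicciFlow.integral_mul_scalarCurvature_add_gradSq_kernel_le` — (a), from
  `IsRicciFlow.kernelWEntropy_le_kernelNashEntropy` (`KernelNashEntropyPole.lean`) and
  `wEntropy_eq_nashEntropy_add` (`NashEntropy.lean`);
* `IsRicciFlow.integral_sq_entropyPotential_sub_kernel_le` — (b), from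
  `heinNaber_poincare_heatKernelMeasure` (`HeatKernelPoincare.lean`) and (a).

These are the inputs of Bamler's bounds on `|∇𝒩*|` (2020a §5.3). Everything is proved; no
definitions, no named facts. The dimension hypothesis `3 ≤ m` is inherited from the pole lemma
`IsRicciFlow.tendsto_mul_kernelNashEntropy`.

## References

* R. H. Bamler, *Entropy and heat kernel bounds on a Ricci flow background*, arXiv:2008.07093
  (2020), §5.1 (Prop. 5.2 and the last proposition of §5.1), §5.2 (its proof).
  [Bamler2020Entropy]
* H.-J. Hein, A. Naber, *New logarithmic Sobolev inequalities and an ε-regularity theorem for the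
  Ricci flow*, Comm. Pure Appl. Math. 67 (2014), Thm. 1.10. [HeinNaber2014]
-/

noncomputable section

open Bundle Set Function Filter Manifold MeasureTheory Measure TopologicalSpace
open scoped Manifold ContDiff Topology ENNReal NNReal

namespace Literature.Geometry.Riemannian

open Lorentzian Lorentzian.PseudoRiemannianMetric

section PotentialBounds

variable {m : ℕ} {H : Type*} [TopologicalSpace H]
  {I : ModelWithCorners ℝ (EuclideanSpace ℝ (Fin m)) H} [I.Boundaryless]
  {M : Type*} [TopologicalSpace M] [ChartedSpace H M] [IsManifold I ∞ M]
  [T2Space M] [CompactSpace M] [SecondCountableTopology M] [MeasurableSpace M] [BorelSpace M]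
  [PreconnectedSpace M]
  {g : ℝ → PseudoRiemannianMetric I ∞ (EuclideanSpace ℝ (Fin m)) (TangentSpace I : M → Type _)}
  {cov : ℝ → CovariantDerivative I (EuclideanSpace ℝ (Fin m)) (TangentSpace I : M → Type _)}
  {a T : ℝ} (hflow : IsRicciFlow g cov (Icc a T)) (hh : IsContMDiffFamilyOn ∞ g univ)
  (hR' : ∀ r, (g r).IsRiemannian)

/-- The time-`r` slice `y ↦ K(x₀,t₀;y,r)` of the conjugate heat kernel is `C^∞` for `r ∈ (a, t₀)`.
[cite: Bamler2020Entropy, §2.3] -/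
theorem IsRicciFlow.contMDiff_heatKernelFn_slice {t₀ : ℝ} (ht₀ : t₀ ∈ Ioc a T) (x₀ : M) {r : ℝ}
    (hr : r ∈ Ioo a t₀) :
    ContMDiff I 𝓘(ℝ, ℝ) ∞ fun y ↦ hflow.heatKernelFn hh hR' t₀ x₀ (y, r) := by
  have hK := hflow.heatKernelFn_contMDiffOn hh hR' ht₀ x₀
  have hι : ContMDiff I (I.prod 𝓘(ℝ, ℝ)) ∞ fun y : M ↦ (y, r) :=
    contMDiff_id.prodMk contMDiff_const
  exact hK.comp_contMDiff hι fun y ↦ ⟨mem_univ _, hr⟩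

/-- **Bamler 2020a, §5.1 (arXiv v1 Prop. 21), first bound**: for the conjugate heat kernel
`u = K(x₀,t₀;·,·)` of a Ricci flow on a closed manifold modelled on `ℝᵐ` (`m ≥ 3`), its potential
`f = −log u − (m/2) log(4π(t₀ − r))` and `τ = t₀ − r`, `r ∈ (a, t₀)`:

  `∫_M τ (R + |∇f|²) u dV_{g(r)} ≤ m/2`

("`= n/2 + 𝒲 − 𝒩 ≤ n/2`": `wEntropy_eq_nashEntropy_add` and `𝒲 ≤ 𝒩`,
`IsRicciFlow.kernelWEntropy_le_kernelNashEntropy`).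
[cite: Bamler2020Entropy, §5.1–5.2, Prop. 21 (arXiv v1), first bound] -/
theorem IsRicciFlow.integral_mul_scalarCurvature_add_gradSq_kernel_le (hm : 3 ≤ m) {t₀ : ℝ}
    (ht₀ : t₀ ∈ Ioc a T) (x₀ : M) {r : ℝ} (hr : r ∈ Ioo a t₀) :
    ∫ y, (t₀ - r) * ((g r).scalarCurvatureWith (cov r) y +
        (g r).gradSq
          (entropyPotential (fun r y ↦ hflow.heatKernelFn hh hR' t₀ x₀ (y, r)) m t₀ r) y) *
        hflow.heatKernelFn hh hR' t₀ x₀ (y, r) ∂(g r).riemVolume ≤ (m : ℝ) / 2 := by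
  set u : ℝ → M → ℝ := fun r y ↦ hflow.heatKernelFn hh hR' t₀ x₀ (y, r) with hu
  have hrT : r ∈ Icc a T := ⟨hr.1.le, hr.2.le.trans ht₀.2⟩
  have hlt : r < t₀ := hr.2
  have hpos : ∀ y, 0 < u r y := fun y ↦ hflow.heatKernelFn_pos hh hR' ht₀ x₀ ⟨mem_univ _, hr⟩
  have hus : ContMDiff I 𝓘(ℝ, ℝ) ∞ (u r) := hflow.contMDiff_heatKernelFn_slice hh hR' ht₀ x₀ hr
  have hfs : ContMDiff I 𝓘(ℝ, ℝ) ∞ (entropyPotential u m t₀ r) := contMDiff_neg_log_sub hus hpos _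
  have hRc : Continuous fun y ↦ (g r).scalarCurvatureWith (cov r) y :=
    (contMDiff_scalarCurvatureWith_holds I M (g r) (cov r) (hflow.isLeviCivita r hrT)).continuous
  have hmass : ∫ y, u r y ∂(g r).riemVolume = 1 :=
    hflow.integral_heatKernelFn_eq_one hh hR' ht₀ x₀ hr
  have hcomp : (g r).IsEntropyCompatible (entropyPotential u m t₀ r) (t₀ - r) := by
    rw [PseudoRiemannianMetric.isEntropyCompatible_iff, finrank_euclideanSpace_fin,
      entropyDensity_entropyPotential m hpos hlt]
    exact hmass
  have hW := wEntropy_eq_nashEntropy_add (g r) (cov r) hRc hfs hcomp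
  have hN := pointedNashEntropy_eq_nashEntropy g (u := u) (τ₀ := t₀) hpos hlt
  rw [finrank_euclideanSpace_fin] at hW hN
  rw [entropyDensity_entropyPotential m hpos hlt, ← hN] at hW
  have hWN := hflow.kernelWEntropy_le_kernelNashEntropy hh hR' hm ht₀ x₀ hr
  rw [hW] at hWN
  -- `τ ∫ (R + |∇f|²) u + 𝒩 − m/2 ≤ 𝒩`
  have key : (t₀ - r) * ∫ y, ((g r).scalarCurvatureWith (cov r) y +
      (g r).gradSq (entropyPotential u m t₀ r) y) * u r y ∂(g r).riemVolume ≤ (m : ℝ) / 2 := by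
    linarith
  rw [← integral_const_mul] at key
  refine le_of_eq_of_le ?_ key
  refine integral_congr_ae (Eventually.of_forall fun y ↦ ?_)
  simp only [hu]
  ring

/-- **Bamler 2020a, §5.1 (arXiv v1 Prop. 21), second bound**: for the conjugate heat kernel
`u = K(x₀,t₀;·,·)` of a Ricci flow on a closed manifold modelled on `ℝᵐ` (`m ≥ 3`), its potential
`f` at time `r ∈ (a, t₀)`, `τ = t₀ − r`, the pointed Nash entropy `𝒩 = 𝒩_{x₀,t₀}(τ)`, and a lower
bound `R(·, r) ≥ R_min`:

  `∫_M (f − 𝒩 − m/2)² u dV_{g(r)} ≤ m − 2 R_min τ`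

(the `ν`-mean of `f` is `∫ f u dV = 𝒩 + m/2`; Hein–Naber's Poincaré inequality
`heinNaber_poincare_heatKernelMeasure` gives `≤ 2τ ∫ |∇f|² u dV`, and the first bound gives
`2τ∫|∇f|² u ≤ m − 2τ ∫ R u ≤ m − 2 R_min τ`).
[cite: Bamler2020Entropy, §5.1–5.2, Prop. 21 (arXiv v1), second bound]
[cite: HeinNaber2014, Thm 1.10] -/
theorem IsRicciFlow.integral_sq_entropyPotential_sub_kernel_le (hm : 3 ≤ m) {t₀ : ℝ}
    (ht₀ : t₀ ∈ Ioc a T) (x₀ : M) {r : ℝ} (hr : r ∈ Ioo a t₀) {Rmin : ℝ}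
    (hRmin : ∀ y, Rmin ≤ (g r).scalarCurvatureWith (cov r) y) :
    ∫ y, (entropyPotential (fun r y ↦ hflow.heatKernelFn hh hR' t₀ x₀ (y, r)) m t₀ r y -
        (pointedNashEntropy g (fun r y ↦ hflow.heatKernelFn hh hR' t₀ x₀ (y, r)) m t₀ r +
          (m : ℝ) / 2)) ^ 2 * hflow.heatKernelFn hh hR' t₀ x₀ (y, r) ∂(g r).riemVolume ≤
      (m : ℝ) - 2 * Rmin * (t₀ - r) := by
  haveI : IsFiniteMeasure (g r).riemVolume := ⟨(g r).riemVolume_univ_lt_top⟩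
  set u : ℝ → M → ℝ := fun r y ↦ hflow.heatKernelFn hh hR' t₀ x₀ (y, r) with hu
  set f : M → ℝ := entropyPotential u m t₀ r with hf
  set N : ℝ := pointedNashEntropy g u m t₀ r with hN
  have hrT : r ∈ Icc a T := ⟨hr.1.le, hr.2.le.trans ht₀.2⟩
  have hlt : r < t₀ := hr.2
  have hτ : 0 < t₀ - r := sub_pos.2 hlt
  have hpos : ∀ y, 0 < u r y := fun y ↦ hflow.heatKernelFn_pos hh hR' ht₀ x₀ ⟨mem_univ _, hr⟩
  have hus : ContMDiff I 𝓘(ℝ, ℝ) ∞ (u r) := hflow.contMDiff_heatKernelFn_slice hh hR' ht₀ x₀ hr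
  have hfs : ContMDiff I 𝓘(ℝ, ℝ) ∞ f := contMDiff_neg_log_sub hus hpos _
  have huc : Continuous (u r) := hus.continuous
  have hfc : Continuous f := hfs.continuous
  have hf1 : ContMDiff I 𝓘(ℝ, ℝ) 1 f := hfs.of_le (by norm_cast)
  have hGc : Continuous fun y ↦ (g r).gradSq f y := continuous_innerDual_mvfderiv (g r) hf1 hf1
  have hRc : Continuous fun y ↦ (g r).scalarCurvatureWith (cov r) y :=
    (contMDiff_scalarCurvatureWith_holds I M (g r) (cov r) (hflow.isLeviCivita r hrT)).continuous
  have hi : ∀ {φ : M → ℝ}, Continuous φ → Integrable φ (g r).riemVolume := fun hφ ↦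
    hφ.integrable_of_hasCompactSupport (HasCompactSupport.of_compactSpace _)
  have hmass : ∫ y, u r y ∂(g r).riemVolume = 1 :=
    hflow.integral_heatKernelFn_eq_one hh hR' ht₀ x₀ hr
  -- the `ν`-integral of `φ` is `∫ φ u dV`
  have hν : ∀ φ : M → ℝ, ∫ y, φ y ∂(heatKernelMeasure hh hR' t₀ x₀ r) =
      ∫ y, φ y * u r y ∂(g r).riemVolume := fun φ ↦
    hflow.integral_heatKernelMeasure_eq_integral_mul_heatKernelFn hh hR' ht₀ x₀ hr φ
  -- the mean of `f` is `𝒩 + m/2`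
  have hmean : ∫ y, f y ∂(heatKernelMeasure hh hR' t₀ x₀ r) = N + (m : ℝ) / 2 := by
    rw [hν, hN, pointedNashEntropy_def]
    ring
  -- Hein–Naber's Poincaré inequality for `f`
  have hP := heinNaber_poincare_heatKernelMeasure hflow hh hR' hr.1 hlt ht₀.2 x₀ hfs
  rw [hmean, hν, hν] at hP
  -- the first bound, split into its `R` and `|∇f|²` parts
  have hA := hflow.integral_mul_scalarCurvature_add_gradSq_kernel_le hh hR' hm ht₀ x₀ hr
  have h1 : Integrable (fun y ↦ (t₀ - r) * ((g r).scalarCurvatureWith (cov r) y * u r y))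
      (g r).riemVolume := by
    have h0 : Integrable (fun y ↦ (g r).scalarCurvatureWith (cov r) y * u r y) (g r).riemVolume :=
      hi (hRc.mul huc)
    exact h0.const_mul _
  have h2 : Integrable (fun y ↦ (t₀ - r) * ((g r).gradSq f y * u r y)) (g r).riemVolume := by
    have h0 : Integrable (fun y ↦ (g r).gradSq f y * u r y) (g r).riemVolume := hi (hGc.mul huc)
    exact h0.const_mul _
  have hsplit : ∫ y, (t₀ - r) * ((g r).scalarCurvatureWith (cov r) y + (g r).gradSq f y) * u r y
      ∂(g r).riemVolume =
      (t₀ - r) * ∫ y, (g r).scalarCurvatureWith (cov r) y * u r y ∂(g r).riemVolume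
        + (t₀ - r) * ∫ y, (g r).gradSq f y * u r y ∂(g r).riemVolume := by
    have e : (fun y ↦ (t₀ - r) * ((g r).scalarCurvatureWith (cov r) y + (g r).gradSq f y) * u r y) =
        fun y ↦ (t₀ - r) * ((g r).scalarCurvatureWith (cov r) y * u r y) +
          (t₀ - r) * ((g r).gradSq f y * u r y) := by
      funext y; ring
    rw [e, integral_add h1 h2, integral_const_mul, integral_const_mul]
  rw [hsplit] at hA
  -- `∫ R u ≥ R_min`
  have hRint : Rmin ≤ ∫ y, (g r).scalarCurvatureWith (cov r) y * u r y ∂(g r).riemVolume := by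
    calc Rmin = ∫ y, Rmin * u r y ∂(g r).riemVolume := by rw [integral_const_mul, hmass, mul_one]
      _ ≤ ∫ y, (g r).scalarCurvatureWith (cov r) y * u r y ∂(g r).riemVolume :=
        integral_mono ((hi huc).const_mul _) (hi (hRc.mul huc)) fun y ↦
          mul_le_mul_of_nonneg_right (hRmin y) (hpos y).le
  have hRτ : (t₀ - r) * Rmin ≤
      (t₀ - r) * ∫ y, (g r).scalarCurvatureWith (cov r) y * u r y ∂(g r).riemVolume :=
    mul_le_mul_of_nonneg_left hRint hτ.le
  calc ∫ y, (f y - (N + (m : ℝ) / 2)) ^ 2 * u r y ∂(g r).riemVolume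
      ≤ 2 * (t₀ - r) * ∫ y, (g r).gradSq f y * u r y ∂(g r).riemVolume := hP
    _ ≤ (m : ℝ) - 2 * Rmin * (t₀ - r) := by nlinarith

end PotentialBounds

end Literature.Geometry.Riemannian

end
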